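import Mathlib
import HarnessLib
import Summits.ABC.ABC.Theses.CongruentialReceptacle
import Summits.ABC.ABC.Theorems.CongruentialReceptacleReceptacleIdentityStableSzpiroDefs
import Summits.ABC.ABC.Theorems.CongruentialReceptacleTameLocalReceptacleGivesTarget

/-!
# Crux `ReceptacleIdentity` (stmt-ABC-1813), line `stable-szpiro-duality`: stub A1

Registered stub `stub_stableSzpiroAt_of_tameLocalReceptacleAt` of the checked skeleton
`Cruxes/ReceptacleIdentity/Lines/stable_szpiro_duality.lean`:

  `∀ κ ε : ℝ, TameLocalReceptacleAt κ ε → StableSzpiroAt κ ε`.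

The crux at one `(κ, ε)` implies Stable Szpiro at `(κ, ε)` with the SAME constants `c₁, c₁', c₃`.

Proof. Fix a signed family `F`. Put `N := Σ_{T ∈ supp} abc` (so `abc ≤ N` on the support) and
the a-priori bound `Z := Σ_{T ∈ supp} |Σ_{p ∣ abc} upperW(D_p T)|`. Choose a prime `ℓ ≥ N + 5`
(`5 ≤ ℓ`, and `ℓ ∤ abc` on the support since `0 < abc ≤ N < ℓ`) and the exponent
`n := m₀ + ⌈2Z⌉₊ + ⌈2c₃⌉₊ + 1 < ℓ ^ n`. The crux hands a table `t` in its windows and, for each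
`T ∈ supp`, an integer `B_T` with `|B_T| ≤ c₃` and `S_T := Σ_{p ∣ abc} t(D_p T) ≡ B_T (mod ℓⁿ)`; the
upper window gives `|S_T| ≤ Z`, so both sides are `< ℓⁿ / 2` in absolute value and the congruence is
an equality (`congruenceToEquality_of_two_mul_abs_lt`): `|S_T| ≤ c₃`. Pairing `∂F` with the real
table `d ↦ t(d)` is linear (`Finsupp.linearCombination`), so
`⟨∂F, t⟩ = Σ_T w_T S_T ≤ Σ_T |w_T| c₃ = c₃ ‖F‖₁`, and termwise on the support of `∂F` (whose data
have prime first coordinate) `m⁺ · lowerW − m⁻ · upperW ≤ m · t(d)` from `lowerW ≤ t ≤ |t| ≤ upperW`,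
i.e. `Φ(∂F) ≤ ⟨∂F, t⟩`.

No literature input. Uses the landed Defs file (p133899) and
`Summit.ABC.ABC.Theorems.congruenceToEquality_of_two_mul_abs_lt`.
-/

-- `Summit.<Summit>.<Problem>` is the mandated summit-side namespace (CONVENTIONS §2); for the
-- single-conjunct summit `ABC` the two coincide, so the duplicate `ABC.ABC` is deliberate.
set_option linter.dupNamespace false

namespace Summit.ABC.ABC.Theorems.StableSzpiro

open Literature.NumberTheory.DiophantineGeometry (IsABCTriple rad)
open Summit.ABC.ABC.Theses.CongruentialReceptacle
open Finset

variable {κ : ℝ}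

/-- The crux's windows, read at a datum with prime first coordinate:
`lowerW ≤ t(d)` and `|t(d)| ≤ upperW` (definitional unfolding of `lowerW`, `upperW`, `Datum.eval`).
[folklore] -/
private theorem window_datum {c₁ c₁' ε : ℝ} {t : ℕ → ℕ → ℕ → ℕ → ℕ → ℕ → ℕ → ℤ}
    (ht : ∀ p i j k r s z : ℕ, p.Prime →
      c₁ * (2 * ((i + j + k : ℕ) : ℝ) - 6 - ε) * Real.log p ≤ (t p i j k r s z : ℝ) ∧
      |(t p i j k r s z : ℝ)| ≤ c₁' * (((i + j + k : ℕ) : ℝ) + 1) * Real.log p)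
    (d : Datum) (hd : d.p.Prime) :
    lowerW c₁ ε d ≤ ((d.eval t : ℤ) : ℝ) ∧ |((d.eval t : ℤ) : ℝ)| ≤ upperW c₁' d :=
  ht d.p d.i d.j d.k d.r d.s d.z hd

/-- Termwise box inequality: if `L ≤ x` and `|x| ≤ U` then `m⁺ L − m⁻ U ≤ m x`. [folklore] -/
private theorem posPart_mul_sub_negPart_mul_le {m L U x : ℝ} (hL : L ≤ x) (hU : |x| ≤ U) :
    max m 0 * L - max (-m) 0 * U ≤ m * x := by
  rcases le_total 0 m with hm | hm
  · rw [max_eq_left hm, max_eq_right (by linarith), zero_mul, sub_zero]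
    exact mul_le_mul_of_nonneg_left hL hm
  · rw [max_eq_right hm, max_eq_left (by linarith), zero_mul, zero_sub]
    have hxU : x ≤ U := (le_abs_self x).trans hU
    have h := mul_le_mul_of_nonpos_left hxU hm
    linarith

/-- The box functional is below every pairing with a real table inside the windows on the support:
`Φ(μ) ≤ Σ_d μ(d) · x(d)` whenever `lowerW(d) ≤ x(d)` and `|x(d)| ≤ upperW(d)` on `supp μ`. [folklore] -/
private theorem Phi_le_sum_mul {c₁ c₁' ε : ℝ} (μ : Datum →₀ ℝ) (x : Datum → ℝ)
    (hwin : ∀ d ∈ μ.support, lowerW c₁ ε d ≤ x d ∧ |x d| ≤ upperW c₁' d) :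
    Phi c₁ c₁' ε μ ≤ μ.sum (fun d m => m * x d) := by
  unfold Phi Finsupp.sum
  exact Finset.sum_le_sum fun d hd => posPart_mul_sub_negPart_mul_le (hwin d hd).1 (hwin d hd).2

/-- Every datum in the support of `∂F` has prime first coordinate (it is some `D_p(T)` with
`p ∣ abc`). [folklore] -/
private theorem prime_of_mem_support_bdry (F : SignedFamily κ) {d : Datum}
    (hd : d ∈ F.bdry.support) : d.p.Prime := by
  unfold SignedFamily.bdry at hd
  obtain ⟨T, -, hT⟩ := Finsupp.mem_support_finsetSum d hd
  have hT' := Finsupp.support_smul hT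
  unfold boundary at hT'
  obtain ⟨p, hp, hp'⟩ := Finsupp.mem_support_finsetSum d hT'
  rw [Finsupp.mem_support_single] at hp'
  rw [hp'.1]
  exact Nat.prime_of_mem_primeFactors hp

/-- Linearity of the pairing: `Σ_d (∂F)(d) · x(d) = Σ_T w_T Σ_{p ∣ abc} x(D_p T)`. [folklore] -/
private theorem bdry_sum_mul (F : SignedFamily κ) (x : Datum → ℝ) :
    F.bdry.sum (fun d m => m * x d) =
      ∑ T ∈ F.supp, F.w T * ∑ p ∈ (T.1 * T.2.1 * T.2.2).primeFactors, x (datumAt T.1 T.2.1 T.2.2 p) := by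
  have key : ∀ μ : Datum →₀ ℝ, μ.sum (fun d m => m * x d) = Finsupp.linearCombination ℝ x μ :=
    fun μ => rfl
  rw [key, SignedFamily.bdry, map_sum]
  refine Finset.sum_congr rfl fun T _ => ?_
  rw [map_smul, boundary, map_sum, smul_eq_mul]
  congr 1
  refine Finset.sum_congr rfl fun p _ => ?_
  rw [Finsupp.linearCombination_single, one_smul]

/-- **Stub A1 of line `stable-szpiro-duality` (crux stmt-ABC-1813).** The tame-local receptacle at
one `(κ, ε)` implies Stable Szpiro at `(κ, ε)` with the same constants: for a finite signed family
read the crux at a prime-power modulus above the height of every triple in the support (congruence =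
equality), pair `∂F` with the table, and compare with the box minimum termwise. [folklore] -/
theorem stub_stableSzpiroAt_of_tameLocalReceptacleAt :
    ∀ κ ε : ℝ, TameLocalReceptacleAt κ ε → StableSzpiroAt κ ε := by
  rintro κ ε ⟨c₁, c₁', c₃, hc₁, m₀, H⟩
  refine ⟨c₁, c₁', c₃, hc₁, fun F => ?_⟩
  -- the height bound `abc ≤ N` on the support
  set N : ℕ := ∑ T ∈ F.supp, T.1 * T.2.1 * T.2.2 with hN
  have hleN : ∀ T ∈ F.supp, T.1 * T.2.1 * T.2.2 ≤ N := fun T hT =>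
    Finset.single_le_sum_of_canonicallyOrdered (f := fun T : ℕ × ℕ × ℕ => T.1 * T.2.1 * T.2.2) hT
  -- the a-priori bound `Z` on every triple sum, uniform in the modulus
  set Z : ℝ := ∑ T ∈ F.supp,
    |∑ p ∈ (T.1 * T.2.1 * T.2.2).primeFactors, upperW c₁' (datumAt T.1 T.2.1 T.2.2 p)| with hZ
  have hleZ : ∀ T ∈ F.supp,
      ∑ p ∈ (T.1 * T.2.1 * T.2.2).primeFactors, upperW c₁' (datumAt T.1 T.2.1 T.2.2 p) ≤ Z :=
    fun T hT => (le_abs_self _).trans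
      (Finset.single_le_sum (s := F.supp) (f := fun T : ℕ × ℕ × ℕ =>
        |∑ p ∈ (T.1 * T.2.1 * T.2.2).primeFactors, upperW c₁' (datumAt T.1 T.2.1 T.2.2 p)|)
        (fun _ _ => abs_nonneg _) hT)
  -- the modulus: a prime `ℓ ≥ N + 5` and an exponent `n` with `ℓ ^ n` above everything
  obtain ⟨ℓ, hℓge, hℓp⟩ := Nat.exists_infinite_primes (N + 5)
  have h5 : 5 ≤ ℓ := by omega
  set n : ℕ := m₀ + ⌈2 * Z⌉₊ + ⌈2 * c₃⌉₊ + 1 with hn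
  have hnlt : n < ℓ ^ n := Nat.lt_pow_self (by omega)
  have hm₀ : m₀ ≤ ℓ ^ n := by omega
  have hnR : 2 * Z < (n : ℝ) ∧ 2 * c₃ < (n : ℝ) := by
    rw [hn]
    push_cast
    constructor
    · linarith [Nat.le_ceil (2 * Z), Nat.le_ceil (2 * c₃), (Nat.cast_nonneg m₀ : (0 : ℝ) ≤ m₀),
        (Nat.cast_nonneg ⌈2 * c₃⌉₊ : (0 : ℝ) ≤ ⌈2 * c₃⌉₊)]
    · linarith [Nat.le_ceil (2 * Z), Nat.le_ceil (2 * c₃), (Nat.cast_nonneg m₀ : (0 : ℝ) ≤ m₀),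
        (Nat.cast_nonneg ⌈2 * Z⌉₊ : (0 : ℝ) ≤ ⌈2 * Z⌉₊)]
  have hpowR : (n : ℝ) < ((ℓ ^ n : ℕ) : ℝ) := by exact_mod_cast hnlt
  -- the table at modulus `ℓ ^ n`
  obtain ⟨t, ht, hB⟩ := H ℓ n hℓp h5 hm₀
  -- every triple sum on the support is an integer of absolute value `≤ c₃`
  have hST : ∀ T ∈ F.supp,
      |∑ p ∈ (T.1 * T.2.1 * T.2.2).primeFactors,
        (((datumAt T.1 T.2.1 T.2.2 p).eval t : ℤ) : ℝ)| ≤ c₃ := by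
    intro T hT
    obtain ⟨habc, ha, hb⟩ := F.balanced T hT
    have ha0 : T.1 ≠ 0 := Nat.pos_iff_ne_zero.mp habc.1
    have hb0 : T.2.1 ≠ 0 := Nat.pos_iff_ne_zero.mp habc.2.1
    have hc0 : T.2.2 ≠ 0 := by
      have := habc.2.2.1
      omega
    have hN0 : T.1 * T.2.1 * T.2.2 ≠ 0 := mul_ne_zero (mul_ne_zero ha0 hb0) hc0
    have hℓN : ¬ ℓ ∣ T.1 * T.2.1 * T.2.2 := by
      intro h
      have := Nat.le_of_dvd (Nat.pos_of_ne_zero hN0) h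
      have := hleN T hT
      omega
    obtain ⟨B, hBle, hcong⟩ := hB T.1 T.2.1 T.2.2 habc ha hb hℓN
    rw [← tripleSum_eq] at hcong
    rw [← Int.cast_sum]
    set S : ℤ := ∑ p ∈ (T.1 * T.2.1 * T.2.2).primeFactors, (datumAt T.1 T.2.1 T.2.2 p).eval t
      with hS
    -- upper window: `|S| ≤ Z`
    have hSabs : |(S : ℝ)| ≤ Z := by
      refine le_trans ?_ (hleZ T hT)
      rw [hS, Int.cast_sum]
      refine (Finset.abs_sum_le_sum_abs _ _).trans ?_
      exact Finset.sum_le_sum fun p hp =>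
        (window_datum ht (datumAt T.1 T.2.1 T.2.2 p) (Nat.prime_of_mem_primeFactors hp)).2
    -- congruence to equality
    have hSlt : 2 * |S| < ((ℓ ^ n : ℕ) : ℤ) := by
      have h : 2 * |(S : ℝ)| < ((ℓ ^ n : ℕ) : ℝ) := by linarith [hnR.1]
      exact_mod_cast h
    have hBlt : 2 * |B| < ((ℓ ^ n : ℕ) : ℤ) := by
      have h : 2 * |(B : ℝ)| < ((ℓ ^ n : ℕ) : ℝ) := by linarith [hnR.2, abs_nonneg (B : ℝ)]
      exact_mod_cast h
    have hSB : S = B := congruenceToEquality_of_two_mul_abs_lt hcong hSlt hBlt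
    rw [hSB]
    exact hBle
  -- `Φ(∂F) ≤ ⟨∂F, t⟩ = Σ_T w_T S_T ≤ c₃ ‖F‖₁`
  have hPhi : Phi c₁ c₁' ε F.bdry ≤ F.bdry.sum (fun d m => m * (((d.eval t : ℤ) : ℝ))) :=
    Phi_le_sum_mul _ _ fun d hd => window_datum ht d (prime_of_mem_support_bdry F hd)
  rw [bdry_sum_mul] at hPhi
  refine hPhi.trans ?_
  rw [SignedFamily.l1, Finset.mul_sum]
  refine Finset.sum_le_sum fun T hT => ?_
  calc F.w T * ∑ p ∈ (T.1 * T.2.1 * T.2.2).primeFactors, (((datumAt T.1 T.2.1 T.2.2 p).eval t : ℤ) : ℝ)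
      ≤ |F.w T| * |∑ p ∈ (T.1 * T.2.1 * T.2.2).primeFactors,
          (((datumAt T.1 T.2.1 T.2.2 p).eval t : ℤ) : ℝ)| := by
        rw [← abs_mul]
        exact le_abs_self _
    _ ≤ |F.w T| * c₃ := mul_le_mul_of_nonneg_left (hST T hT) (abs_nonneg _)
    _ = c₃ * |F.w T| := mul_comm _ _

end Summit.ABC.ABC.Theorems.StableSzpiro
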